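import Summits.BirchSwinnertonDyer.BirchSwinnertonDyer.Theorems.RamifiedSevenEllipticUnitsRelativeValuationOfDatumPinned
import Summits.BirchSwinnertonDyer.Rank1Residual.X12.O11.RamifiedRubinPackageLineZp
import Summits.BirchSwinnertonDyer.Rank1Residual.X12.CMSevenAwayFromSeven
import HarnessLib

set_option linter.dupNamespace false
set_option autoImplicit false

/-!
# K7r value crux `EllipticUnitValueSevenOfGZK` (stmt-BirchSwinnertonDyer-19945), line `rubin-formula-zp` v4:
# `S_pkg ⟹ S_relval` — the registered stub `stub_relativeValuationSevenZp` FROM the jointly normalised Rubin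
# package, through k7r-c3 g9's relative valuation theorem on the typed [BKNO] datum
# (cell `bsd-cm`, line owner `bsd-cm-k7r-c4` g8; `--supports` 19945; sorry-free; nothing about BSD asserted)

HONEST FRAMING. `X12/O11/RamifiedRubinPackageLineZp.lean` (p495100) types `S_pkg =
RamifiedCMRubinPackageAtZp W p D₀`: inside `S_relval`'s telescope, ONE existential package `(cK, R, Ω₀, 𝓔₀,
D₀', R₀)` of [BKNO] Rubin `p`-adic `L`-function data for the member and the base with the clauses (P1)–(P8)
(choice `η_ac = 𝟙` = planner LEMMA Ξ, signs, ramification, `Ω₀ ≠ 0`, (F2), unit base, relative period law,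
(R3) reading). Seat k7r-c3 g9 proved `RelativeValuationOfDatum.natCast_eq_padicValRat_of_data`: for two data
`R`, `R₀` under exactly these hypotheses, `(l : ℤ) = padicValRat p r` for the squared central-value ratio `r`
of the INTERPOLATED characters `φ^{k+1}(φ∘c)^k ξ₁^k`. THIS FILE: (P1) rewrites those characters to the odd
powers `φ^{2k+1}`, `φ₀^{2k+1}` (k7r-c3 g9's `RelativeValuationOfDatum.interpolatedCharacter_eq_pow`, p494612), whose central values
`heckeCentralValue (φ^(2k+1)) k` ARE the line's carrier `heckePowerCentralValue φ k` (`rfl`), so the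
registered `S_relval` follows from `S_pkg` for every `W`, `p`, `D₀`
(`ramifiedCMRelativeValuationAtZp_of_package`), and on 𝒞₇ at `p = 7`, `D₀ = −11` in the registered stub shape
(`relativeValuationSevenZp_of_package`). CONDITIONAL on the package (a typed input); nothing closed; [BKNO] is
an unrefereed preprint entering only through the bound data; BSD is not proved by any of this.

References: [BKNO] arXiv:2608.06879v1 Def. 4.7, Thm. 4.12, Thm. 7.2 [BurungaleKobayashiNakamuraOta2026]; cell
texts RELATIVE-RUBIN-ram-g9.md §1, STATUS D131 (03:30Z/03:40Z), planner LEMMA Ξ (03:54:59Z).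
-/

noncomputable section

open scoped Classical

namespace Summit.BirchSwinnertonDyer.BirchSwinnertonDyer.Theorems.RamifiedSevenEllipticUnits

namespace RelativeValuationOfPackage

open WeierstrassCurve NumberField IsDedekindDomain Field PowerSeries
  Literature.NumberTheory.EllipticCurves
  Literature.NumberTheory.EllipticCurves.Rank1Residual
  Literature.NumberTheory.EllipticCurves.BurungaleKobayashiNakamuraOta2026
  Literature.NumberTheory.GaloisRepresentations
  Literature.NumberTheory.DiophantineGeometry
  Summit.BirchSwinnertonDyer.Rank1Residual Summit.BirchSwinnertonDyer.Rank1Residual.X12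
  Summit.BirchSwinnertonDyer.Rank1Residual.X12.O11

/-- **`S_pkg ⟹ S_relval`** (every `W`, `p`, `D₀`): destructure the package at the given instance of the
telescope, rewrite the two interpolated characters to `φ^{2k+1}`, `φ₀^{2k+1}` by (P1)
(k7r-c3 g9's `RelativeValuationOfDatum.interpolatedCharacter_eq_pow`; then `heckeCentralValue (φ^(2k+1)) k` is `heckePowerCentralValue φ k` by
`rfl`), and apply k7r-c3 g9's `RelativeValuationOfDatum.natCast_eq_padicValRat_of_data` with (P2)–(P8);
`p ≥ 5` comes from the frame. CONDITIONAL on `S_pkg`.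
[cite: BurungaleKobayashiNakamuraOta2026, Thm. 4.12 and Thm. 7.2 (arXiv:2608.06879 pp. 32, 41) (claim; preprint; fields of the bound data)] -/
theorem ramifiedCMRelativeValuationAtZp_of_package {W : WeierstrassCurve ℚ} [W.IsElliptic]
    [W.IsGloballyMinimal] {p : ℕ} [Fact p.Prime] {D₀ : ℤ}
    (hpkg : RamifiedCMRubinPackageAtZp W p D₀) : RamifiedCMRelativeValuationAtZp W p D₀ := by
  intro K _ _ 𝔭 W' _ _ C hF hr κ hκ γ _ P n P' n' hP hgen htors hdiv hndiv hP' hgen' htors' hdiv' hndiv'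
    q q' hq hq' ι φ Ω 𝓔 D c hΩ hφ hc himc l hl W₀ _ _ hW₀ φ₀ hφ₀ m r hcont hcont₀ hρ hr0 hlt
  obtain ⟨cK, R, Ω₀, 𝓔₀, D₀', R₀, hξ, hξ₀, hsgn, hsgn₀, hram, hram₀, hΩ₀, hu, hu₀, hbase, hper, hbottom⟩ :=
    hpkg K 𝔭 W' C hF hr κ hκ γ P n P' n' hP hgen htors hdiv hndiv hP' hgen' htors' hdiv' hndiv' q q' hq hq'
      ι φ Ω 𝓔 D c hΩ hφ hc himc l hl W₀ hW₀ φ₀ hφ₀ m r hcont hcont₀ hρ hr0 hlt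
  have h5 : 5 ≤ p := hF.2.2.1
  have hρ' : (heckeCentralValue (φ ^ (p ^ m + 1) * HeckeCharacter.galConj cK φ ^ (p ^ m) *
        R.ξ ^ (p ^ m) * 1) (p ^ m) /
      heckeCentralValue (φ₀ ^ (p ^ m + 1) * HeckeCharacter.galConj cK φ₀ ^ (p ^ m) *
        R₀.ξ ^ (p ^ m) * 1) (p ^ m)) ^ 2 = (r : ℂ) := by
    rw [RelativeValuationOfDatum.interpolatedCharacter_eq_pow hξ (p ^ m),
      RelativeValuationOfDatum.interpolatedCharacter_eq_pow hξ₀ (p ^ m)]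
    exact hρ
  exact RelativeValuationOfDatum.natCast_eq_padicValRat_of_data R R₀ h5 m hsgn hsgn₀ hram hram₀ hΩ hΩ₀
    hu hu₀ hbase hper hr0 hρ' hlt hbottom

/-- **On 𝒞₇ at `p = 7`, `D₀ = −11`, in the registered stub shapes**: `(∀ W ∈ 𝒞₇, S_pkg W 7 (−11)) ⟹
(∀ W ∈ 𝒞₇, S_relval W 7 (−11))` — the v4 skeleton derives `stub_relativeValuationSevenZp` from
`stub_rubinPackageSevenZp` through this. CONDITIONAL on the package.
[cite: BurungaleKobayashiNakamuraOta2026, Thm. 4.12 and Thm. 7.2 (arXiv:2608.06879 pp. 32, 41) (claim; preprint; shape only)] -/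
theorem relativeValuationSevenZp_of_package
    (hpkg : ∀ (W : WeierstrassCurve ℚ) [W.IsElliptic] [W.IsGloballyMinimal] [Fact (Nat.Prime 7)],
      X12.ClassCSeven W → RamifiedCMRubinPackageAtZp W 7 (-11)) :
    ∀ (W : WeierstrassCurve ℚ) [W.IsElliptic] [W.IsGloballyMinimal] [Fact (Nat.Prime 7)],
      X12.ClassCSeven W → RamifiedCMRelativeValuationAtZp W 7 (-11) :=
  fun W _ _ _ hC => ramifiedCMRelativeValuationAtZp_of_package (hpkg W hC)

end RelativeValuationOfPackage

end Summit.BirchSwinnertonDyer.BirchSwinnertonDyer.Theorems.RamifiedSevenEllipticUnits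

end
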